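import Literature.MathematicalPhysics.QuantumFieldTheory.Balaban1983to89.B9Cor35CDirInputsAtOne

/-!
# `Balaban1983to89.B9Cor35CDirCarrierAtOne` — [Balaban1985BackgroundPropagators] Cor. 3.5 p. 407 ∕ p. 409 l. 1–5 AT `U = 1` FOR PRINT's DIRICHLET THIRD CUBE
# LETTER ON ITS OWN CARRIER `P = 𝔖 × ι` (the unit-lattice blocks INSIDE `Ω₀(□)`): the binders `hLinv` («`(Q′G′²Q′*)·C⁻¹ = 1`») and `h348` (Theorem 3.2) of
# Sect. B's engine `B9Thm34InvBlk.thm34_Cinv_uniform_blk` DISCHARGED at `Qc := 𝔖|Q′_□(1)`, `Qcs := Q′*_□(1)|𝔖`, `Gp := GpDirK`, `Linv := CinvR` (ROAD (I) U6b-i; seat dag-n06-c g33)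

statement-level skeleton of published theorems with citation tags; proofs where landed; nothing here is a claim about the Yang–Mills mass gap

## What this file does (mathematically)

[Balaban1985BackgroundPropagators] (3.21)∕(3.25) pp. 394–395 with Dirichlet conditions on `Ω₀(□)` (p. 394, p. 409 l. 1–5): the third letter
`C_□(U) = (Q′_□(U)G′_□(U)²Q′*_□(U))⁻¹` lives on the blocks `𝔖` inside `Ω₀(□)` — off `𝔖` the block word vanishes, so the honest carrier of Theorem 3.4's
`C`-step (p. 403 (3.65)–(3.67), r06's carrier-generic `thm34_Cinv_uniform_blk`, block carrier `P`, block map `blkP`) is `P := 𝔖 × ι`, `blkP := val ∘ fst`.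
This file builds that carrier and discharges the engine's two `U = 1` binders there:
* §1 the restriction ∕ extension matrices `resMatY 𝔖 : 𝔖 × X`, `extMatY 𝔖 : X × 𝔖` (`res·M·ext = M|_𝔖`, `res·ext = 1`, `ext·res = 𝟙_𝔖`) and their lifts;
* §2 the letters on the carrier: `QcR V := conjHom b (res♯ ∘ Q′_□(V))`, `QcsR V := conjHom b (Q′*_□(V) ∘ ext♯)`, `CinvR V := conj b (η⁻⁴·res♯ ∘ C_□(V) ∘ ext♯)`
  (def-Y's `XinvCubeDY` at the knit cube legs, ANY `V`), and at `U = 1`: `CinvR 1 = conj b (η⁻⁴·(K_X|_𝔖)♯)` (FILE `B9Cor35CDirInputsAtOne.XinvCubeDY_dirDomY_one`);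
* §3 ★ the `U = 1` block word on the carrier: `QcR 1 ∘ (GpDirK·GpDirK) ∘ QcsR 1 = conj b (η⁴·(X^{Dir}(1)|_𝔖)♯)` — the PADDING `1 − 𝟙_{Ω₀}` of UNIT 1's
  `GpDirK = conj b(η²(padΔ_{□,Ω₀}(1))⁻¹)` is invisible from the blocks inside `Ω₀(□)` (`padWord_apply_inside`); ★★★ `hLinv_CinvR` : `(QcR 1 ∘ Gp² ∘ QcsR 1)·CinvR 1 = 1`
  and `CinvR_mul_word` (the other side) — FILE `B9CubeDirichletCLetterAtOne.hKX_dirDomY` lifted;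
* §4 ★★ `h348_CinvR` ∕ ★★★ `thm32_CinvR` : Theorem 3.2 (3.48) for `CinvR 1` over `(toB6 (geoCK i □) Rr H, val ∘ fst)`, constants `d, L` only
  (FILE `B9CubeDirichletCLetterDecayAtOne.thm32_dirC_cube`).

## Status

Printed-statement pass + proof body (proof-backed; a port in the tree's vocabulary): [Balaban1985BackgroundPropagators] pp. 394–395, 398, 403, 407, 409,
re-read 2026-08-31.  Honest label: two of the `A`-independent binders of Thm 3.4's `C`-engine at the Dirichlet cube letter, `U = 1`; the (3.19)∕(3.59) two-space
majorants of `QcR ∕ QcsR` and the engine run itself (`U ≠ 1`, Sect. B) are NOT here.  Node N06 of the `pub-ymgap` DAG is NOT discharged here and the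
Yang–Mills mass gap is NOT proved here.  NEW file; nothing landed is modified.  No `sorry`, no `axiom`, no `instance`, no `notation`.  Net new unproved
facts: 0.  Cell `pub-ymgap` (HUMAN RULING D-0062), node N06 [B9], seat `pub-ymgap-dag-n06-c` (g33), 2026-08-31.
RELATED, NOT DUPLICATED (searched 2026-08-31: `rg 'resMatY|extMatY|QcR |QcsR |CinvR|hLinv_CinvR|padWord_apply_inside'` over `Literature ∕ Summits` = ∅): r05
`B9Cor36CubeCinvAtOne.hLinv_cube ∕ h348_cube` (the WHOLE-TORUS letter on ALL blocks), FILE `B9Cor35CDirInputsAtOne` (`CinvDirK` on all blocks — its rows;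
the carrier form is what the engine consumes).
-/

noncomputable section

namespace Literature.MathematicalPhysics.QuantumFieldTheory.Balaban1983to89.B9Cor35CDirCarrierAtOne

open B6KLevelCensusIndexV1 (KIdx kGeo)
open B6Cover236MultiLevelBlocks (cubes)
open B6RandomWalk (HasMajorant BlockSupp hasMajorant_mono)
open B6Geom246MultiLevelBoxL0 (blkOf)
open B6Geom246MultiLevelTorusL0 (geomT)
open B6Ineq288MultiLevelTorusL0 (QM)
open B9Thm34Ext (toB6)
open B9Eq352DivFormLetters (conj)
open B9Eq376POneLetters (conjHom conjHom_comp conjHom_eq_conj)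
open B9CubeLettersOpsL0 (cubeFamY oddMh)
open B9CubeLettersBondOpsL0 (BlkCubeY qpKc qpsKc QpCubeY QpsCubeY QpCubeY_one QpsCubeY_one)
open B9Cor35GpCubeInputsAtOne (hasMajorant_conj_of_liftY hasMajorant_smul liftY_smul conj_one')
open B9Cor36CubeCinvAtOne (len_reshape_neg4)
open B9CubeGeometryInputs (geoCK)
open B9Cor35GpDirInputsAtOne (dirDomY GpDirOneY GpDirPadW GpDirK compr_GpDirOneY GpDirPadW_eq_add ringInverse_padDeltaCubeY_one_eq_liftOpY)
open B9Eq3105DirichletBondLettersAtOneY (xDirMatY)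
open B9CubeDirichletCLetterAtOne (kxDirY hKX_dirDomY xDirMatY_dirDomY_eq)
open B9CubeDirichletCLetterDecayAtOne (thm32_dirC_cube)
open B9Cor35CDirInputsAtOne (XinvCubeDY_dirDomY_one kxDirY_mul_xDirMatY_inside)
open Node00 (SiteY CfgY toKT liftY liftY_apply liftOpY liftOpY_liftY liftOpY_eq_liftMatY liftMatY liftMatY_mul liftMatY_one)
open Node00.OpsYCubeDirInverse (indDiagY indDiagY_apply GpDirY)
open Node00.OpsYCubeKnitPar (parKnitCubeY parKnitCubeY_one)
open Node00.OpsYCubeProjectionG (insideBlkY mem_insideBlkY_iff XinvCubeDY)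
open scoped Matrix

/-! ## §1 The restriction and extension matrices of a sub-carrier -/

section Carrier

variable {X : Type} [Fintype X] [DecidableEq X] (𝔖 : Finset X)

/-- the RESTRICTION matrix `𝔖 × X`: `res v x = [v = x]`. [cite: Balaban1985BackgroundPropagators, p.394 («Ω₀ denotes a characteristic function»), dictionary] -/
def resMatY : Matrix ↥𝔖 X ℝ := fun v x => if (v : X) = x then 1 else 0

/-- the EXTENSION-BY-ZERO matrix `X × 𝔖`: `ext x v = [x = v]`. [cite: Balaban1985BackgroundPropagators, p.394, dictionary] -/
def extMatY : Matrix X ↥𝔖 ℝ := fun x v => if x = (v : X) then 1 else 0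

/-- `(res·M) v y = M v y`. [cite: Balaban1985BackgroundPropagators, p.394, bookkeeping] -/
theorem resMatY_mul_apply {Y : Type} [Fintype Y] (M : Matrix X Y ℝ) (v : ↥𝔖) (y : Y) : (resMatY 𝔖 * M) v y = M v.1 y := by
  rw [Matrix.mul_apply]
  simp only [resMatY, ite_mul, one_mul, zero_mul, Finset.sum_ite_eq, Finset.mem_univ, if_true]

/-- `(M·ext) y v = M y v`. [cite: Balaban1985BackgroundPropagators, p.394, bookkeeping] -/
theorem mul_extMatY_apply {Y : Type} [Fintype Y] (M : Matrix Y X ℝ) (y : Y) (v : ↥𝔖) : (M * extMatY 𝔖) y v = M y v.1 := by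
  rw [Matrix.mul_apply]
  simp only [extMatY, mul_ite, mul_one, mul_zero, Finset.sum_ite_eq', Finset.mem_univ, if_true]

/-- ★ `res·M·ext = M|_𝔖`. [cite: Balaban1985BackgroundPropagators, p.394 («Ω₀Δ′_aΩ₀»), bookkeeping] -/
theorem resMatY_mul_mul_extMatY (M : Matrix X X ℝ) :
    resMatY 𝔖 * M * extMatY 𝔖 = M.submatrix (fun v : ↥𝔖 => (v : X)) (fun v : ↥𝔖 => (v : X)) := by
  ext v w
  rw [mul_extMatY_apply, resMatY_mul_apply, Matrix.submatrix_apply]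

/-- `res·ext = 1`. [cite: Balaban1985BackgroundPropagators, p.394, bookkeeping] -/
theorem resMatY_mul_extMatY : resMatY 𝔖 * extMatY 𝔖 = 1 := by
  ext v w
  rw [resMatY_mul_apply, extMatY, Matrix.one_apply]
  by_cases h : v = w
  · rw [if_pos (congrArg Subtype.val h), if_pos h]
  · rw [if_neg (fun h' => h (Subtype.ext h')), if_neg h]

omit [Fintype X] in
/-- `ext·res = 𝟙_𝔖`. [cite: Balaban1985BackgroundPropagators, p.394, bookkeeping] -/
theorem extMatY_mul_resMatY : extMatY 𝔖 * resMatY 𝔖 = indDiagY 𝔖 := by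
  ext x y
  rw [Matrix.mul_apply, indDiagY_apply]
  by_cases hx : x ∈ 𝔖
  · rw [Finset.sum_eq_single (⟨x, hx⟩ : ↥𝔖)]
    · simp only [extMatY, resMatY, if_true, one_mul]
      by_cases hxy : x = y
      · rw [if_pos hxy, if_pos ⟨hxy, hx⟩]
      · rw [if_neg hxy, if_neg (fun h => hxy h.1)]
    · intro v _ hv
      have : x ≠ (v : X) := fun h => hv (Subtype.ext h.symm)
      simp only [extMatY, if_neg this, zero_mul]
    · intro h; exact absurd (Finset.mem_univ _) h
  · rw [if_neg (fun h => hx h.2)]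
    refine Finset.sum_eq_zero fun v _ => ?_
    have : x ≠ (v : X) := fun h => hx (h ▸ v.2)
    simp only [extMatY, if_neg this, zero_mul]

end Carrier

/-! ## §2 The Dirichlet third cube letter and its companions ON THE CARRIER `𝔖 × ι` -/

section Letters

variable {d ℓ : ℕ} {hd : 1 ≤ d + 1} {hL : Odd (ℓ + 1) ∧ 1 < ℓ + 1} {b₀ b₁ : ℝ}
variable {𝔸 : Type} [NormedRing 𝔸] [NormedAlgebra ℂ 𝔸] [CompleteSpace 𝔸]
variable {ι : Type} [Fintype ι] (b : Module.Basis ι ℝ 𝔸)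
variable (i : KIdx d ℓ hd hL b₀ b₁) (c : ↥(cubes (toKT i).D.toDomains))

/-- **`𝔖 := insideBlkY i □ Ω₀(□)`** — the carrier's block set. [cite: Balaban1985BackgroundPropagators, p.409 l.1–5, dictionary] -/
abbrev SBlk : Finset (BlkCubeY i c) := insideBlkY i c (dirDomY i c)

/-- **`Qc(V) := 𝔖|Q′_□(V)`** — the cube averaging letter read on the carrier (conj-`b` two-space form). [cite: Balaban1985BackgroundPropagators, (3.19)–(3.21) p.394, p.409] -/
def QcR (V : CfgY 𝔸 i) : (SiteY i × ι → ℝ) →ₗ[ℝ] (↥(SBlk i c) × ι → ℝ) :=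
  conjHom b ((liftMatY 𝔸 (resMatY (SBlk i c))).restrictScalars ℝ ∘ₗ (QpCubeY i c (parKnitCubeY i c) V).restrictScalars ℝ)

/-- **`Qcs(V) := Q′*_□(V)|𝔖`**. [cite: Balaban1985BackgroundPropagators, (3.19)–(3.21) p.394, p.409] -/
def QcsR (V : CfgY 𝔸 i) : (↥(SBlk i c) × ι → ℝ) →ₗ[ℝ] (SiteY i × ι → ℝ) :=
  conjHom b ((QpsCubeY i c (parKnitCubeY i c) V).restrictScalars ℝ ∘ₗ (liftMatY 𝔸 (extMatY (SBlk i c))).restrictScalars ℝ)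

/-- **`CinvR(V) := conj b (η⁻⁴·𝔖|C_□(V)|𝔖)`** — def-Y's Dirichlet third cube letter at the knit cube legs, read on the carrier, print's units.
[cite: Balaban1985BackgroundPropagators, (3.21) p.394, Thm 3.2 (3.48) p.398, p.409 l.1–5] -/
def CinvR (V : CfgY 𝔸 i) : Module.End ℝ (↥(SBlk i c) × ι → ℝ) :=
  conj b ((((kGeo i).eta ^ 4)⁻¹) • ((liftMatY 𝔸 (resMatY (SBlk i c))).restrictScalars ℝ ∘ₗ
    (XinvCubeDY i c (parKnitCubeY i c) (GpDirY i c (parKnitCubeY i c) (dirDomY i c)) (SBlk i c) V).restrictScalars ℝ ∘ₗ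
    (liftMatY 𝔸 (extMatY (SBlk i c))).restrictScalars ℝ))

/-- ★ **AT `U = 1`: `CinvR 1 = conj b (η⁻⁴·(K_X|_𝔖)♯)`** (FILE `B9Cor35CDirInputsAtOne.XinvCubeDY_dirDomY_one`). [cite: Balaban1985BackgroundPropagators, p.409 l.1–5, Cor. 3.5 p.407] -/
theorem CinvR_one : CinvR b i c (fun _ _ => 1) =
    conj b ((((kGeo i).eta ^ 4)⁻¹) • (liftMatY 𝔸 ((kxDirY i c).submatrix (fun v : ↥(SBlk i c) => (v : BlkCubeY i c))
      (fun v : ↥(SBlk i c) => (v : BlkCubeY i c)))).restrictScalars ℝ) := by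
  rw [CinvR, XinvCubeDY_dirDomY_one i c, liftOpY_eq_liftMatY, ← LinearMap.restrictScalars_comp, ← LinearMap.restrictScalars_comp, ← liftMatY_mul,
    ← liftMatY_mul, ← Matrix.mul_assoc, resMatY_mul_mul_extMatY]

/-! ## §3 The `U = 1` block word on the carrier and the law `hLinv` -/

omit [NormedRing 𝔸] [NormedAlgebra ℂ 𝔸] [CompleteSpace 𝔸] [Fintype ι] in
/-- ★ **THE PADDING IS INVISIBLE FROM INSIDE**: on the rows of blocks inside `Ω₀(□)`, `q′_□·Gpad·Gpad·q′*_□ = q′_□·G′_□(1)·G′_□(1)·q′*_□ = X^{Dir}(1)`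
(`Gpad = G′_□(1) + (1 − 𝟙_{Ω₀})`, `G′(1 − 𝟙) = 0 = (1 − 𝟙)G′`, and `q′_□(s, ·)` is supported in `Ω₀(□)` for `s` inside).
[cite: Balaban1985BackgroundPropagators, p.394 («Ω₀Δ′_aΩ₀»), (3.25) p.394, p.409 l.1–5] -/
theorem padWord_apply_inside (s : ↥(SBlk i c)) (t : BlkCubeY i c) :
    (qpKc i c * GpDirPadW i c * GpDirPadW i c * qpsKc i c) s.1 t = xDirMatY i c (dirDomY i c) (GpDirOneY i c) s.1 t := by
  classical
  rw [xDirMatY_dirDomY_eq, GpDirPadW_eq_add]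
  have hP : indDiagY (R := ℝ) (dirDomY i c) * indDiagY (dirDomY i c) = indDiagY (dirDomY i c) :=
    Node00.OpsYCubeDirInverse.indDiagY_mul_indDiagY _
  have hGP : GpDirOneY i c * indDiagY (dirDomY i c) = GpDirOneY i c := by
    conv_lhs => rw [← compr_GpDirOneY i c]
    rw [Matrix.mul_assoc, hP, compr_GpDirOneY]
  have hPG : indDiagY (dirDomY i c) * GpDirOneY i c = GpDirOneY i c := by
    conv_lhs => rw [← compr_GpDirOneY i c]
    rw [← Matrix.mul_assoc, ← Matrix.mul_assoc, hP, compr_GpDirOneY]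
  have hGE : GpDirOneY i c * (1 - indDiagY (dirDomY i c)) = 0 := by rw [Matrix.mul_sub, Matrix.mul_one, hGP, sub_self]
  have hEG : (1 - indDiagY (dirDomY i c)) * GpDirOneY i c = 0 := by rw [Matrix.sub_mul, Matrix.one_mul, hPG, sub_self]
  have hEE : (1 - indDiagY (R := ℝ) (dirDomY i c)) * (1 - indDiagY (dirDomY i c)) = 1 - indDiagY (dirDomY i c) := by
    rw [Matrix.sub_mul, Matrix.one_mul, Matrix.mul_sub, Matrix.mul_one, hP, sub_self, sub_zero]
  have hsq : (GpDirOneY i c + (1 - indDiagY (dirDomY i c))) * (GpDirOneY i c + (1 - indDiagY (dirDomY i c))) =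
      GpDirOneY i c * GpDirOneY i c + (1 - indDiagY (dirDomY i c)) := by
    rw [Matrix.add_mul, Matrix.mul_add, Matrix.mul_add, hGE, hEG, hEE, add_zero, zero_add]
  rw [Matrix.mul_assoc (qpKc i c), hsq, Matrix.mul_add, Matrix.add_mul, Matrix.add_apply, ← Matrix.mul_assoc, add_eq_left]
  -- the padding term: row `s` of `q′_□·(1 − 𝟙)` vanishes
  rw [Matrix.mul_apply]
  refine Finset.sum_eq_zero fun x _ => ?_
  have hrow : ((qpKc i c * ((1 : Matrix (SiteY i) (SiteY i) ℝ) - indDiagY (dirDomY i c)) : Matrix (BlkCubeY i c) (SiteY i) ℝ)) s.1 x = 0 := by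
    rw [Matrix.mul_sub, Matrix.mul_one, Matrix.sub_apply, indDiagY, Matrix.mul_diagonal]
    by_cases hx : x ∈ dirDomY i c
    · rw [if_pos hx, mul_one, sub_self]
    · rw [if_neg hx, mul_zero, sub_zero]
      show (if blkOf (cubeFamY i c).toDomains x = s.1 then (B6Ineq268MultiLevelBoxL0.W (cubeFamY i c).toDomains s.1)⁻¹ else 0) = 0
      rw [if_neg]
      intro hb
      exact hx ((mem_insideBlkY_iff i c _ _).1 s.2 x hb)
  rw [hrow, zero_mul]

omit [NormedRing 𝔸] [NormedAlgebra ℂ 𝔸] [CompleteSpace 𝔸] [Fintype ι] in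
/-- hence `res·(q′Gpad²q′*)·ext = X^{Dir}(1)|_𝔖`. [cite: Balaban1985BackgroundPropagators, (3.25) p.394, p.409 l.1–5, bookkeeping] -/
theorem res_padWord_ext :
    resMatY (SBlk i c) * (qpKc i c * GpDirPadW i c * GpDirPadW i c * qpsKc i c) * extMatY (SBlk i c) =
      (xDirMatY i c (dirDomY i c) (GpDirOneY i c)).submatrix (fun v : ↥(SBlk i c) => (v : BlkCubeY i c)) (fun v : ↥(SBlk i c) => (v : BlkCubeY i c)) := by
  rw [resMatY_mul_mul_extMatY]
  ext s t
  rw [Matrix.submatrix_apply, Matrix.submatrix_apply]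
  exact padWord_apply_inside i c s t.1

/-- UNIT 1's `GpDirK` at the knit cube legs, as a lift. [cite: Balaban1985BackgroundPropagators, (3.25) p.395, Cor. 3.5 p.407, bookkeeping] -/
theorem GpDirK_parKnit_eq : GpDirK b i c (parKnitCubeY i c) = conj b (((kGeo i).eta ^ 2) • (liftMatY 𝔸 (GpDirPadW i c)).restrictScalars ℝ) := by
  rw [GpDirK, ringInverse_padDeltaCubeY_one_eq_liftOpY i c (parKnitCubeY i c) (parKnitCubeY_one i c), liftOpY_eq_liftMatY]

/-- ★ **THE `U = 1` BLOCK WORD ON THE CARRIER**: `QcR 1 ∘ (Gp·Gp) ∘ QcsR 1 = conj b (η⁴·(X^{Dir}(1)|_𝔖)♯)`, `Gp := GpDirK b i □ (parKnitCubeY i □)`.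
[cite: Balaban1985BackgroundPropagators, (3.21)∕(3.25) pp.394–395, p.409 l.1–5, Cor. 3.5 p.407; Balaban1984PropagatorsII, (2.52) p.232] -/
theorem word_one :
    QcR b i c (fun _ _ => 1) ∘ₗ (GpDirK b i c (parKnitCubeY i c) * GpDirK b i c (parKnitCubeY i c)) ∘ₗ QcsR b i c (fun _ _ => 1) =
      conj b (((kGeo i).eta ^ 4) • (liftMatY 𝔸 ((xDirMatY i c (dirDomY i c) (GpDirOneY i c)).submatrix
        (fun v : ↥(SBlk i c) => (v : BlkCubeY i c)) (fun v : ↥(SBlk i c) => (v : BlkCubeY i c)))).restrictScalars ℝ) := by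
  have hC : (liftMatY 𝔸 (resMatY (SBlk i c)) ∘ₗ liftMatY 𝔸 (qpKc i c)) ∘ₗ
      ((liftMatY 𝔸 (GpDirPadW i c) ∘ₗ liftMatY 𝔸 (GpDirPadW i c)) ∘ₗ (liftMatY 𝔸 (qpsKc i c) ∘ₗ liftMatY 𝔸 (extMatY (SBlk i c)))) =
      liftMatY 𝔸 ((xDirMatY i c (dirDomY i c) (GpDirOneY i c)).submatrix (fun v : ↥(SBlk i c) => (v : BlkCubeY i c))
        (fun v : ↥(SBlk i c) => (v : BlkCubeY i c))) := by
    rw [← res_padWord_ext i c]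
    simp only [liftMatY_mul, LinearMap.comp_assoc]
  rw [QcR, QcsR, QpCubeY_one i c (parKnitCubeY_one i c), QpsCubeY_one i c (parKnitCubeY_one i c), GpDirK_parKnit_eq,
    ← B9Eq352DivFormLetters.conj_mul, smul_mul_smul_comm, ← conjHom_eq_conj, conjHom_comp, conjHom_comp, ← conjHom_eq_conj]
  congr 1
  rw [Module.End.mul_eq_comp, LinearMap.smul_comp, LinearMap.comp_smul, ← pow_add]
  congr 1
  exact congrArg (LinearMap.restrictScalars ℝ) hC

/-- ★★★ **BINDER `hLinv` OF `thm34_Cinv_uniform_blk` AT THE DIRICHLET CUBE LETTER, `U = 1`**: `(QcR 1 ∘ Gp² ∘ QcsR 1)·CinvR 1 = 1` on `𝔖 × ι`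
(FILE `B9CubeDirichletCLetterAtOne.hKX_dirDomY`, lifted). [cite: Balaban1985BackgroundPropagators, (3.21)∕(3.25) pp.394–395, p.409 l.1–5, Cor. 3.5 p.407; Balaban1984PropagatorsII, Prop. 2.3 p.238] -/
theorem hLinv_CinvR :
    (QcR b i c (fun _ _ => 1) ∘ₗ (GpDirK b i c (parKnitCubeY i c) * GpDirK b i c (parKnitCubeY i c)) ∘ₗ QcsR b i c (fun _ _ => 1)) *
      CinvR b i c (fun _ _ => 1) = 1 := by
  have hη4 : ((kGeo i).eta ^ 4 : ℝ) ≠ 0 := pow_ne_zero 4 (B9Cor35GpCubeInputsAtOne.eta_ne_zero i)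
  rw [word_one, CinvR_one, ← B9Eq352DivFormLetters.conj_mul, smul_mul_smul_comm, mul_inv_cancel₀ hη4, one_smul, Module.End.mul_eq_comp,
    ← LinearMap.restrictScalars_comp, ← liftMatY_mul, hKX_dirDomY, liftMatY_one]
  exact conj_one' b

/-- ★ … and `CinvR 1·(QcR 1 ∘ Gp² ∘ QcsR 1) = 1`. [cite: Balaban1985BackgroundPropagators, p.409 l.1–5; Balaban1984PropagatorsII, Prop. 2.3 p.238] -/
theorem CinvR_mul_word :
    CinvR b i c (fun _ _ => 1) *
      (QcR b i c (fun _ _ => 1) ∘ₗ (GpDirK b i c (parKnitCubeY i c) * GpDirK b i c (parKnitCubeY i c)) ∘ₗ QcsR b i c (fun _ _ => 1)) = 1 := by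
  have hη4 : ((kGeo i).eta ^ 4 : ℝ) ≠ 0 := pow_ne_zero 4 (B9Cor35GpCubeInputsAtOne.eta_ne_zero i)
  rw [word_one, CinvR_one, ← B9Eq352DivFormLetters.conj_mul, smul_mul_smul_comm, inv_mul_cancel₀ hη4, one_smul, Module.End.mul_eq_comp,
    ← LinearMap.restrictScalars_comp, ← liftMatY_mul, kxDirY_mul_xDirMatY_inside, liftMatY_one]
  exact conj_one' b

end Letters

/-! ## §4 Theorem 3.2 (3.48) for `CinvR 1` over `(toB6 (geoCK i □) Rr H, val ∘ fst)` -/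

section Rows

variable {d ℓ : ℕ} {hd : 1 ≤ d + 1} {hL : Odd (ℓ + 1) ∧ 1 < ℓ + 1} {b₀ b₁ : ℝ}
variable {𝔸 : Type} [NormedRing 𝔸] [NormedAlgebra ℂ 𝔸] [CompleteSpace 𝔸]
variable {ι : Type} [Fintype ι] (b : Module.Basis ι ℝ 𝔸)
variable (i : KIdx d ℓ hd hL b₀ b₁) (c : ↥(cubes (toKT i).D.toDomains))

omit [NormedRing 𝔸] [NormedAlgebra ℂ 𝔸] [CompleteSpace 𝔸] [Fintype ι] in
/-- **AN ENTRYWISE BOUND ON A SUB-CARRIER IS A BLOCK MAJORANT** for the block map `val` (a test function supported on one block of the big carrier meets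
at most one point of the sub-carrier). [cite: Balaban1984PropagatorsII, (2.51) p.232; Balaban1985BackgroundPropagators, (3.48) p.398, bookkeeping] -/
theorem hasMajorant_toLin'_val_of_abs_le (Rr : ℝ) (H : Prop) (𝔖 : Finset (BlkCubeY i c)) (M : Matrix ↥𝔖 ↥𝔖 ℝ)
    {K : BlkCubeY i c → BlkCubeY i c → ℝ} (hK : ∀ a a', 0 ≤ K a a') (hM : ∀ u w, |M u w| ≤ K u.1 w.1) :
    HasMajorant (g := toB6 (geoCK i c) Rr H) (fun v : ↥𝔖 => (v : BlkCubeY i c)) (Matrix.toLin' M) K := by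
  intro y' μ B hμ u
  rw [Matrix.toLin'_apply, Matrix.mulVec, dotProduct]
  by_cases hy : y' ∈ 𝔖
  · rw [Finset.sum_eq_single (⟨y', hy⟩ : ↥𝔖)]
    · rw [abs_mul]
      exact mul_le_mul (hM u ⟨y', hy⟩) (hμ.bound _ rfl) (abs_nonneg _) (hK _ _)
    · intro w _ hw
      rw [hμ.off w (fun h => hw (Subtype.ext h)), mul_zero]
    · intro h; exact absurd (Finset.mem_univ _) h
  · rw [Finset.sum_eq_zero (fun w _ => by rw [hμ.off w (fun h => hy (h ▸ w.2)), mul_zero]), abs_zero]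
    exact mul_nonneg (hK _ _) hμ.nonneg

omit [CompleteSpace 𝔸] in
/-- `η⁻⁴·(K_X|_𝔖)♯ (f ⊗ E) = (η⁻⁴·K_X|_𝔖 f) ⊗ E`. [cite: Balaban1985BackgroundPropagators, Cor. 3.5 p.407, p.409 l.1–5, bookkeeping] -/
theorem smul_liftMatY_sub_liftY (f : ↥(SBlk i c) → ℝ) (E : 𝔸) :
    ((((kGeo i).eta ^ 4)⁻¹) • (liftMatY 𝔸 ((kxDirY i c).submatrix (fun v : ↥(SBlk i c) => (v : BlkCubeY i c))
      (fun v : ↥(SBlk i c) => (v : BlkCubeY i c)))).restrictScalars ℝ) (liftY f E) =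
      liftY ((((kGeo i).eta ^ 4)⁻¹ • Matrix.toLin' ((kxDirY i c).submatrix (fun v : ↥(SBlk i c) => (v : BlkCubeY i c))
        (fun v : ↥(SBlk i c) => (v : BlkCubeY i c)))) f) E := by
  rw [LinearMap.smul_apply, LinearMap.restrictScalars_apply, ← liftOpY_eq_liftMatY, liftOpY_liftY, LinearMap.smul_apply, Matrix.toLin'_apply, liftY_smul]

/-- ★★ **BINDER `h348` ON THE CARRIER**: an entrywise bound `|K_X(y, y′)| ≤ C·((Lʲ)⁴)⁻¹·e^{−δd_T(y,y′)}` (`0 ≤ C`) gives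
`CinvR 1 ≺ C·ℓ(a)^{−4}·e^{−δd}` over `(toB6 (geoCK i □) Rr H, val ∘ fst)`. [cite: Balaban1985BackgroundPropagators, Thm 3.2 (3.48) p.398, p.409 l.1–5; Balaban1984PropagatorsII, (2.51) p.232] -/
theorem h348_CinvR {C δ : ℝ} (hC0 : 0 ≤ C) (Rr : ℝ) (H : Prop)
    (hC : ∀ y y' : BlkCubeY i c, |kxDirY i c y y'| ≤ C * ((((ℓ : ℝ) + 1) ^ y.1.1) ^ 4)⁻¹ * Real.exp (-(δ * (geoCK i c).dist y y'))) :
    HasMajorant (g := toB6 (geoCK i c) Rr H) (fun q : ↥(SBlk i c) × ι => (q.1 : BlkCubeY i c)) (CinvR b i c (fun _ _ => 1))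
      (fun a a' => C * (geoCK i c).len a ^ (-(4 : ℝ)) * Real.exp (-(δ * (geoCK i c).dist a a'))) := by
  have hK : ∀ a a' : BlkCubeY i c, 0 ≤ C * ((((ℓ : ℝ) + 1) ^ a.1.1) ^ 4)⁻¹ * Real.exp (-(δ * (geoCK i c).dist a a')) := fun a a' => by positivity
  have hm := hasMajorant_smul (g := toB6 (geoCK i c) Rr H) (fun v : ↥(SBlk i c) => (v : BlkCubeY i c))
    (hasMajorant_toLin'_val_of_abs_le i c Rr H (SBlk i c) _ hK (fun u w => hC u.1 w.1)) (((kGeo i).eta ^ 4)⁻¹)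
  rw [CinvR_one]
  refine hasMajorant_mono (g := toB6 (geoCK i c) Rr H) _
    (hasMajorant_conj_of_liftY b (g := toB6 (geoCK i c) Rr H) (fun v : ↥(SBlk i c) => (v : BlkCubeY i c)) _ _ (fun f E => ?_) hm) fun a a' => ?_
  · exact smul_liftMatY_sub_liftY i c f E
  · exact (len_reshape_neg4 i c C δ a a').le

/-- ★★★ **THEOREM 3.2 (3.48) AT `U = 1` FOR THE DIRICHLET THIRD CUBE LETTER ON ITS CARRIER**: constants `δ, C, M₀` (on `d, L` only) with
`CinvR b i □ 1 ≺ C·ℓ(a)^{−4}·e^{−δd(a,a′)}` over `(toB6 (geoCK i □) Rr H, val ∘ fst)` for every member with `L·M_h ≥ M₀`, every cover cube, every `Rr, H` —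
the `h348` binder of `thm34_Cinv_uniform_blk` at `P := 𝔖 × ι`. [cite: Balaban1985BackgroundPropagators, Thm 3.2 (3.48) p.398, p.409 l.1–5, Cor. 3.5 p.407; Balaban1984PropagatorsII, Prop. 2.3 (2.87) p.238; Balaban1983RegularityDecay, (2.42) p.584] -/
theorem thm32_CinvR (d ℓ : ℕ) (hℓ : 1 ≤ ℓ) :
    ∃ δ C M₀ : ℝ, 0 < δ ∧ 0 < C ∧ 0 < M₀ ∧
      ∀ {hd : 1 ≤ d + 1} {hL : Odd (ℓ + 1) ∧ 1 < ℓ + 1} {b₀ b₁ : ℝ} (i : KIdx d ℓ hd hL b₀ b₁) (c : ↥(cubes (toKT i).D.toDomains)) (Rr : ℝ) (H : Prop),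
        M₀ ≤ ((ℓ : ℝ) + 1) * (toKT i).Mh →
        HasMajorant (g := toB6 (geoCK i c) Rr H) (fun q : ↥(SBlk i c) × ι => (q.1 : BlkCubeY i c)) (CinvR b i c (fun _ _ => 1))
          (fun a a' => C * (geoCK i c).len a ^ (-(4 : ℝ)) * Real.exp (-(δ * (geoCK i c).dist a a'))) := by
  obtain ⟨δ, C, M₀, hδ, hC, hM₀, h⟩ := thm32_dirC_cube d ℓ hℓ
  exact ⟨δ, C, M₀, hδ, hC, hM₀, fun i c Rr H hM0 => h348_CinvR b i c hC.le Rr H (h i c hM0)⟩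

end Rows

end Literature.MathematicalPhysics.QuantumFieldTheory.Balaban1983to89.B9Cor35CDirCarrierAtOne
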